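import Summits.BirchSwinnertonDyer.BirchSwinnertonDyer.Theses.ShadowIsolation
import Summits.BirchSwinnertonDyer.BirchSwinnertonDyer.Theorems.ShadowIsolationPrimeSupplyIrreducible

/-!
# Disproof work file for crux `PhantomShadow` (stmt-BirchSwinnertonDyer-15787, route ShadowIsolation)

cdisprove seat `refuter-cdisprove-stmt-BirchSwinnertonDyer-15787-0`, cycle 1 (2026-08-17).

## Findings (index)

* **No unconditional kill is possible on this tree, and none is finitely certifiable even on paper** (§4):
  the trigger `∃ σ : W.sha, addOrderOf σ = p ^ n` at a prime `p ≥ 5` with `E[p]` IRREDUCIBLE has no witness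
  in the tree (the tree's Ш-constructions are Kramer `p = 2` and Matsuno `p ∈ {2,3,5,7,13}` through a rational
  `p`-isogeny, i.e. reducible `E[p]`), and the negated conclusion `¬ ShadowAt W p n` quantifies over ALL
  squarefree `M` coprime to `p·N_W` — infinitely many exact non-vanishing statements `L(g,1) ≠ 0`.
* **Statement audit: no junk** (§1): the Fricke element `S·diag(N·M,1)` IS `(0,-1; N·M, 0)` (`fricke_matrix`);
  under Mathlib's slash action (`det^{k-1}` factor) `g ∣ w = -g` is root number `+1` (even), as intended;
  `IsNewform0` (new ∧ eigen for ALL `T_ℓ`/`U_ℓ` ∧ `a₁ = 1`) excludes `g = 0` and the trivial old shadow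
  `h = f - ℓ·f(ℓτ)` (which has `L(h,1) = 0` for free and is `w`-eigen, but is `U_ℓ`-eigen only if
  `a_ℓ = ℓ + 1` exactly); `W.LFunction` is Mathlib's coefficient sequence, so the mismatch clause says `g ≠ f_W`.
* **Depth structure** (§2, proved): the conclusion `ShadowAt W p n` is MONOTONE in `n` (`shadowAt_mono`) and so is
  the trigger (`exists_addOrderOf_eq_pow_of_le`); the conclusion does not mention `σ`.
* **Load-bearing hypotheses** (§3, proved): dropping the Ш-trigger makes the crux INCONSISTENT with its sibling
  crux `IsolationOfAccidentalZeros` (`phantomShadowWithoutTrigger_false_of_isolation`) — any σ-free proof strategy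
  for PhantomShadow (e.g. "deep level raising supplies congruent even newforms at every depth, pick one with a
  central zero") REFUTES the route's other crux; a proof must route through `σ`. Dropping `1 ≤ n` only adds the
  σ-free depth-0 demand `ShadowNoCongruence` (`phantomShadowWithoutPos_iff`, `shadowAt_zero_iff`), a plausible
  (unprovable-here) existence statement: `1 ≤ n` is not load-bearing for falsity. `5 ≤ p`, ordinarity and
  irreducibility are not load-bearing for falsity either (every drop keeps the unconstructible trigger).
* **Strong vs weak congruence** (§5, proved small models): the crux's `φ : R →+* ZMod (p ^ n)` on a ring
  containing the eigenvalues of a GENUINE newform is strictly stronger, for `n ≥ 2`, than an eigen-system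
  `𝕋 → ℤ/pⁿ` of a Hecke algebra (`twistedHom_not_factor_fst/snd`: the Hecke algebra `{(a,b) : a ≡ b mod p}` of two
  newforms congruent mod `p` maps onto `ℤ/p²` without factoring through either newform) — so Bertolini–Darmon
  `n`-admissible level raising does not by itself produce the crux's `g`; and a depth `n ≥ 2` congruence cannot
  be carried by a coefficient ring in which `p` is a unit times a square (`no_ringHom_zmod_pow_of_sq_eq`): the
  congruence prime of `O_g` must be unramified of residue degree 1.

## Filed on the Negative lane (proposals, `--supports stmt-BirchSwinnertonDyer-15787`)
* p156083 → `Theorems/PhantomShadow/Negative/WithoutTrigger.lean`: `phantomShadow_false_without_trigger_of_isolation`,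
  `phantomShadow_without_pos_iff` (statements inlined, def-free versions of §3).
* p156096 → `Theorems/PhantomShadow/Negative/DepthAndCongruence.lean`: `PhantomShadowNegative.conclusion_mono`,
  `….exists_addOrderOf_eq_pow_of_le`, `….weak_eigensystem_not_strong`, `….no_ringHom_zmod_pow_of_sq_eq` (§2, §5).

## Line `birth` (registered; lead c3) — stub attack summary (evidence `stub_visibleShadowPointIdeal.md`, 2026-08-17)
`stub_visibleShadowPointIdeal` is the crux plus Shimura data `D` and `Infinite (A_g(ℚ))`: same trigger, same
uncertifiable negation — not refuted, not misstated; joint sufficiency `PhantomShadow_of` is kernel-checked and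
`stub_katoFinite` is sound over `NewformAbelianVariety` (the interface pins `A` up to ℚ-isogeny). What transfers:
(1) §3 — a σ-free discharge of the stub refutes `IsolationOfAccidentalZeros`; (2) §5 — its ideal `I` (`ℤ ∩ I = pⁿℤ`)
needs, for `n ≥ 2`, an unramified degree-one congruence prime, and Bertolini–Darmon `n`-admissible level raising
alone yields only a weak eigen-system; (3) keep the full `IsNewform0 g` in any reshape: weakened to "normalised
eigenform away from the level" the stub is TRUE FOR A SILLY REASON at `M = ℓ` for every odd-sign `W`, via the old
form `h = f_W − ℓ·f_W(ℓτ)` (`w_{Nℓ} h = −λ_N h`, congruent to `f_W` at every depth, `L(h,s) = (1 − ℓ^{1−s})L(f_W,s)`).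

## Disproof used
First Disproof.lean for this crux; STRATEGY-CENSUS.md (crux strategist, 2026-08-17) §Negation reaches the same
uncertifiability verdict (N1) independently; nothing here contradicts the live line `birth` (PICKED.md, lead c3).
-/

set_option linter.dupNamespace false

namespace Summit.BirchSwinnertonDyer.BirchSwinnertonDyer.Cruxes.PhantomShadow.Disproof

open Summit.BirchSwinnertonDyer.BirchSwinnertonDyer.Theses.ShadowIsolation
open Literature.NumberTheory.EllipticCurves.ModularForms
open scoped MatrixGroups

/-! ## §1 The conclusion predicate, and the statement audit -/

/-- `ShadowAt W p n`: VERBATIM the conclusion of `PhantomShadow` at `(W, p, n)` (= the predicate negated in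
`IsolationOfAccidentalZeros`): an even-sign newform `g ≠ f_W` on `Γ₀(N_W·M)`, `M` squarefree coprime to `p·N_W`,
strongly depth-`n` congruent to `W` away from `N_W·M`, whose entire `L`-function vanishes at `s = 1`. -/
def ShadowAt (W : WeierstrassCurve ℚ) [W.IsGloballyMinimal] (p n : ℕ) : Prop :=
  ∃ (M : ℕ) (_ : NeZero (W.conductorNorm ℤ * M))
    (g : CuspForm (CongruenceSubgroup.Gamma0 (W.conductorNorm ℤ * M)) 2) (R : Subring ℂ)
    (φ : R →+* ZMod (p ^ n))
    (hR : ∀ ℓ : ℕ, ℓ.Prime → ¬ ℓ ∣ W.conductorNorm ℤ * M → heckeEigenvalue g ℓ ∈ R),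
    Squarefree M ∧ Nat.Coprime M (p * W.conductorNorm ℤ) ∧ IsNewform0 g ∧
    (∃ m : ℕ, (UpperHalfPlane.qExpansion 1 ⇑g).coeff m ≠ ((W.LFunction m : ℤ) : ℂ)) ∧
    cuspHeckeOperatorₗ (CongruenceSubgroup.Gamma0 (W.conductorNorm ℤ * M)) 2
      (slToGLPos ModularGroup.S * diagGL ((W.conductorNorm ℤ * M : ℕ) : ℚ) 1
        (Nat.cast_pos.mpr (NeZero.pos (W.conductorNorm ℤ * M))) one_pos) g = -g ∧
    (∀ (ℓ : ℕ) (hℓ : ℓ.Prime) (hℓL : ¬ ℓ ∣ W.conductorNorm ℤ * M),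
      φ ⟨heckeEigenvalue g ℓ, hR ℓ hℓ hℓL⟩ = ((W.frobeniusTrace ℓ : ℤ) : ZMod (p ^ n))) ∧
    ∃ Λ : ℂ → ℂ, Differentiable ℂ Λ ∧
      (∀ s : ℂ, 2 < s.re → Λ s = LSeries (fun m ↦ (UpperHalfPlane.qExpansion 1 ⇑g).coeff m) s) ∧ Λ 1 = 0

/-- `PhantomShadow` unfolded over `ShadowAt` (definitional). -/
theorem phantomShadow_iff :
    PhantomShadow ↔ ∀ (W : WeierstrassCurve ℚ) [W.IsElliptic] [W.IsGloballyMinimal] (p : ℕ) [Fact p.Prime],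
      5 ≤ p → W.HasGoodReductionAtPrime p → ¬ (p : ℤ) ∣ W.frobeniusTrace p →
      W.HasIrreducibleModPGaloisRep p → ∀ n : ℕ, 1 ≤ n → (∃ σ : W.sha, addOrderOf σ = p ^ n) →
      ShadowAt W p n :=
  Iff.rfl

/-- `IsolationOfAccidentalZeros` unfolded over `ShadowAt` (definitional): isolation says `¬ ShadowAt W p n`
for all deep `n`. -/
theorem isolation_iff :
    IsolationOfAccidentalZeros ↔ ∀ (W : WeierstrassCurve ℚ) [W.IsElliptic] [W.IsGloballyMinimal] (p : ℕ)
      [Fact p.Prime], 5 ≤ p → W.HasGoodReductionAtPrime p → ¬ (p : ℤ) ∣ W.frobeniusTrace p →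
      W.HasIrreducibleModPGaloisRep p → ∃ n₀ : ℕ, ∀ n : ℕ, n₀ ≤ n → ¬ ShadowAt W p n :=
  Iff.rfl

/-- Audit of the Fricke element: `S · diag(L, 1) = (0, -1; L, 0) = w_L`, the Fricke matrix of level `L`
(it normalises `Γ₀(L)`, so the double-coset operator of the crux is `g ↦ g ∣₂ w_L`, an involution in weight 2;
`g ∣ w_L = -g` is root number `+1`). [folklore] -/
theorem fricke_matrix (L : ℕ) (hL : (0 : ℚ) < L) :
    (((slToGLPos ModularGroup.S * diagGL (L : ℚ) 1 hL one_pos : GL(2, ℚ)⁺) : GL (Fin 2) ℚ) :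
      Matrix (Fin 2) (Fin 2) ℚ) = !![0, -1; (L : ℚ), 0] := by
  ext i j
  fin_cases i <;> fin_cases j <;>
    simp [slToGLPos, diagGL, ModularGroup.S, Matrix.mul_apply, Fin.sum_univ_two,
      Matrix.SpecialLinearGroup.toGLPos, Matrix.SpecialLinearGroup.map,
      Matrix.GeneralLinearGroup.mkOfDetNeZero]

/-! ## §2 Depth structure (proved) -/

/-- The conclusion is MONOTONE in the depth: a depth-`n` shadow is a depth-`m` shadow for `m ≤ n`
(compose `φ` with `ZMod (p ^ n) → ZMod (p ^ m)`). [folklore] -/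
theorem shadowAt_mono {W : WeierstrassCurve ℚ} [W.IsGloballyMinimal] {p m n : ℕ} (hmn : m ≤ n)
    (h : ShadowAt W p n) : ShadowAt W p m := by
  obtain ⟨M, hM, g, R, φ, hR, hsq, hcop, hnew, hmis, hw, hcong, hΛ⟩ := h
  refine ⟨M, hM, g, R, (ZMod.castHom (pow_dvd_pow p hmn) (ZMod (p ^ m))).comp φ, hR, hsq, hcop, hnew,
    hmis, hw, ?_, hΛ⟩
  intro ℓ hℓ hℓL
  rw [RingHom.comp_apply, hcong ℓ hℓ hℓL, map_intCast]

/-- The trigger is MONOTONE in the depth: an element of exact order `p ^ n` has a multiple of exact order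
`p ^ m` for every `m ≤ n` (pure group theory, `p ≠ 0`). [folklore] -/
theorem exists_addOrderOf_eq_pow_of_le {A : Type*} [AddMonoid A] {p m n : ℕ} (hp : p ≠ 0) (hmn : m ≤ n)
    (h : ∃ σ : A, addOrderOf σ = p ^ n) : ∃ τ : A, addOrderOf τ = p ^ m := by
  obtain ⟨σ, hσ⟩ := h
  have hne : addOrderOf σ ≠ 0 := by rw [hσ]; exact pow_ne_zero _ hp
  have hdvd : p ^ m ∣ addOrderOf σ := by rw [hσ]; exact pow_dvd_pow p hmn
  exact ⟨_, addOrderOf_nsmul_addOrderOf_sub hne hdvd⟩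

/-! ## §3 Load-bearing hypotheses (proved) -/

/-- The crux with its Ш-TRIGGER DROPPED: shadows at every depth `n ≥ 1` for every qualifying `(W, p)`. -/
def PhantomShadowWithoutTrigger : Prop :=
  ∀ (W : WeierstrassCurve ℚ) [W.IsElliptic] [W.IsGloballyMinimal] (p : ℕ) [Fact p.Prime],
    5 ≤ p → W.HasGoodReductionAtPrime p → ¬ (p : ℤ) ∣ W.frobeniusTrace p →
    W.HasIrreducibleModPGaloisRep p → ∀ n : ℕ, 1 ≤ n → ShadowAt W p n

/-- A concrete elliptic curve over `ℚ` (`y² = x³ - x`, `Δ = 64`), used only to instantiate the universally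
quantified cruxes. -/
def W₀ : WeierstrassCurve ℚ := ⟨0, 0, 0, -1, 0⟩

theorem W₀_Δ : W₀.Δ = 64 := by
  simp only [W₀, WeierstrassCurve.Δ, WeierstrassCurve.b₂, WeierstrassCurve.b₄, WeierstrassCurve.b₆,
    WeierstrassCurve.b₈]
  norm_num

instance W₀_isElliptic : W₀.IsElliptic := by
  rw [WeierstrassCurve.isElliptic_iff, W₀_Δ]
  norm_num

/-- **The Ш-trigger is load-bearing.** Without it the crux contradicts its sibling crux
`IsolationOfAccidentalZeros`: instantiate both at a global minimal model of `y² = x³ - x`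
(`hasGlobalMinimalModel_rat_holds`) and a good ordinary prime `p ≥ 5` with irreducible `E[p]`
(the route's PROVED support item `PrimeSupplyIrreducible`), at depth `max n₀ 1`. Consequence for provers: the
conclusion of `PhantomShadow` never mentions `σ`, but no σ-free argument can prove it unless the route is dead. -/
theorem phantomShadowWithoutTrigger_false_of_isolation (hI : IsolationOfAccidentalZeros) :
    ¬ PhantomShadowWithoutTrigger := by
  intro hS
  obtain ⟨C, hC⟩ := WeierstrassCurve.hasGlobalMinimalModel_rat_holds W₀
  obtain ⟨p, hp, h5, hgood, hord, hirr⟩ := Theorems.primeSupplyIrreducible_proof (C • W₀)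
  obtain ⟨n₀, hn₀⟩ := hI (C • W₀) p h5 hgood hord hirr
  exact hn₀ (max n₀ 1) (le_max_left _ _) (hS (C • W₀) p h5 hgood hord hirr (max n₀ 1) (le_max_right _ _))

/-- Contrapositive packaging: a σ-free proof of the shadow (= `PhantomShadowWithoutTrigger`) refutes isolation. -/
theorem not_isolation_of_phantomShadowWithoutTrigger (hS : PhantomShadowWithoutTrigger) :
    ¬ IsolationOfAccidentalZeros :=
  fun hI => phantomShadowWithoutTrigger_false_of_isolation hI hS

/-- `PhantomShadow` trivially follows from its trigger-free strengthening (recorded only to make the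
implication lattice explicit; it is NOT a proof strategy, by the previous theorem). -/
theorem phantomShadow_of_withoutTrigger (hS : PhantomShadowWithoutTrigger) : PhantomShadow :=
  fun W _ _ p _ h5 hgood hord hirr n hn _ => hS W p h5 hgood hord hirr n hn

/-- The crux with `1 ≤ n` DROPPED. -/
def PhantomShadowWithoutPos : Prop :=
  ∀ (W : WeierstrassCurve ℚ) [W.IsElliptic] [W.IsGloballyMinimal] (p : ℕ) [Fact p.Prime],
    5 ≤ p → W.HasGoodReductionAtPrime p → ¬ (p : ℤ) ∣ W.frobeniusTrace p →
    W.HasIrreducibleModPGaloisRep p → ∀ n : ℕ, (∃ σ : W.sha, addOrderOf σ = p ^ n) → ShadowAt W p n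

/-- The depth-0 demand with the (then vacuous) congruence clause removed: SOME even-sign newform `g ≠ f_W` at
SOME squarefree coprime level `N_W·M` with `Λ(g,1) = 0`. Plausible for every `W` (e.g. the newform of a
rank-2 curve of conductor `N_W·M`), unprovable here (needs modularity + Kato or an exact central zero). -/
def ShadowNoCongruence (W : WeierstrassCurve ℚ) [W.IsGloballyMinimal] (p : ℕ) : Prop :=
  ∃ (M : ℕ) (_ : NeZero (W.conductorNorm ℤ * M))
    (g : CuspForm (CongruenceSubgroup.Gamma0 (W.conductorNorm ℤ * M)) 2),
    Squarefree M ∧ Nat.Coprime M (p * W.conductorNorm ℤ) ∧ IsNewform0 g ∧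
    (∃ m : ℕ, (UpperHalfPlane.qExpansion 1 ⇑g).coeff m ≠ ((W.LFunction m : ℤ) : ℂ)) ∧
    cuspHeckeOperatorₗ (CongruenceSubgroup.Gamma0 (W.conductorNorm ℤ * M)) 2
      (slToGLPos ModularGroup.S * diagGL ((W.conductorNorm ℤ * M : ℕ) : ℚ) 1
        (Nat.cast_pos.mpr (NeZero.pos (W.conductorNorm ℤ * M))) one_pos) g = -g ∧
    ∃ Λ : ℂ → ℂ, Differentiable ℂ Λ ∧
      (∀ s : ℂ, 2 < s.re → Λ s = LSeries (fun m ↦ (UpperHalfPlane.qExpansion 1 ⇑g).coeff m) s) ∧ Λ 1 = 0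

/-- Any semiring maps to the zero ring `ZMod 1`. -/
def toZModOne (R : Type*) [Semiring R] : R →+* ZMod 1 where
  toFun _ := 0
  map_one' := Subsingleton.elim _ _
  map_mul' _ _ := Subsingleton.elim _ _
  map_zero' := rfl
  map_add' _ _ := Subsingleton.elim _ _

/-- At depth `0` the congruence clause is VACUOUS (`ZMod (p ^ 0) = ZMod 1` is the zero ring): `ShadowAt W p 0`
is exactly `ShadowNoCongruence W p`. -/
theorem shadowAt_zero_iff (W : WeierstrassCurve ℚ) [W.IsGloballyMinimal] (p : ℕ) :
    ShadowAt W p 0 ↔ ShadowNoCongruence W p := by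
  unfold ShadowAt
  rw [pow_zero]
  constructor
  · rintro ⟨M, hM, g, R, φ, hR, hsq, hcop, hnew, hmis, hw, -, hΛ⟩
    exact ⟨M, hM, g, hsq, hcop, hnew, hmis, hw, hΛ⟩
  · rintro ⟨M, hM, g, hsq, hcop, hnew, hmis, hw, hΛ⟩
    refine ⟨M, hM, g, ⊤, toZModOne _, fun _ _ _ => Subring.mem_top _, hsq, hcop, hnew, hmis, hw, ?_, hΛ⟩
    intro ℓ hℓ hℓL
    exact Subsingleton.elim _ _

/-- **`1 ≤ n` is not load-bearing for falsity**: dropping it adds exactly the σ-free depth-0 demand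
`ShadowNoCongruence` at every qualifying `(W, p)` (the trigger at `n = 0` is witnessed by `σ = 0`,
`addOrderOf 0 = 1 = p ^ 0`). -/
theorem phantomShadowWithoutPos_iff :
    PhantomShadowWithoutPos ↔ PhantomShadow ∧
      ∀ (W : WeierstrassCurve ℚ) [W.IsElliptic] [W.IsGloballyMinimal] (p : ℕ) [Fact p.Prime],
        5 ≤ p → W.HasGoodReductionAtPrime p → ¬ (p : ℤ) ∣ W.frobeniusTrace p →
        W.HasIrreducibleModPGaloisRep p → ShadowNoCongruence W p := by
  constructor
  · intro h
    refine ⟨fun W _ _ p _ h5 hg ho hi n _ hσ => h W p h5 hg ho hi n hσ, fun W _ _ p _ h5 hg ho hi => ?_⟩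
    rw [← shadowAt_zero_iff]
    exact h W p h5 hg ho hi 0 ⟨0, by simp⟩
  · rintro ⟨hS, h0⟩ W _ _ p _ h5 hg ho hi n hσ
    rcases Nat.eq_zero_or_pos n with rfl | hn
    · exact (shadowAt_zero_iff W p).mpr (h0 W p h5 hg ho hi)
    · exact hS W p h5 hg ho hi n hn hσ

/-! ## §4 Why there is no unconditional refutation (documentation; nothing is asserted)

* The negation `¬ PhantomShadow` needs a WITNESS `(W, p, n, σ)` with `σ ∈ Ш(W)` of exact order `p ^ n`,
  `p ≥ 5` good ordinary, `E[p]` irreducible. The tree constructs non-zero Ш only for `p = 2` (Kramer,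
  `Literature.NumberTheory.EllipticCurves.KramerDescentShaGProofs`) and for `p ∈ {2,3,5,7,13}` on curves with
  a rational `p`-isogeny (Matsuno, `…MatsunoCurves*`, the barrier `Literature.Barriers.BirchSwinnertonDyer.
  DescentDefectUnbounded*`) — reducible `E[p]`, excluded by `HasIrreducibleModPGaloisRep`. The certified
  irreducible examples in print (Cremona–Mazur 2000 Table 1: Ш[5], Ш[7] at conductors 1058, 1246, 1664, 2834,
  3364, …, several INVISIBLE at level `N`) rest on visibility / Kolyvagin computations not in the tree.
* Given a witness, `¬ ShadowAt W p n` is `∀ M squarefree coprime, ∀ g new even congruent, L(g,1) ≠ 0`: each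
  instance is exactly decidable (modular symbols; `NumericalVanishingBarrier` does not bite a single value) but
  the family is infinite in `M` (Jetchev–Stein 2007 Conj. 7.1.1 has no level bound), so no finite certificate
  and no `kit compute` job can settle it. The route's kill criterion for this item is therefore NOT effective;
  the strategist's census (STRATEGY-CENSUS.md §Negation N1/N2) says the same and locates the heuristically false
  part in the FINITE-Ш sector (deep elements of a finite Ш), which `closes` never uses (idea card
  `phantomshadow-divisible-sector`).
* Mutations tried (all keep an unconstructible object): drop `5 ≤ p` (then Kramer's `p = 2` classes trigger, but
  the infinite non-vanishing remains); drop irreducibility (Matsuno's Ш[5] triggers; same); drop ordinarity / good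
  reduction (nothing changes: neither is used by the visibility mechanism — information for the prover: the
  intended proof uses `5 ≤ p` only through Diamond–Taylor level raising and never uses `p ∤ a_p`).
* NEGATIVE LEMMA MODULO H is not available either: any `H → ¬ PhantomShadow` needs `H` to contain the infinite
  non-vanishing family, i.e. `H` would be (an instance of) `IsolationOfAccidentalZeros ∧ deep Ш`, the sibling crux.
-/

/-! ## §5 Strong versus weak depth-`n` congruences (proved small models)

The crux asks for a GENUINE newform `g` and a ring map `φ : R →+* ZMod (p ^ n)` on a ring `R ∋ a_ℓ(g)`; since
`φ ∘ (ℤ → R)` is reduction mod `pⁿ`, `φ` is onto and `R / ker φ ≅ ℤ/pⁿ` ("strong" congruence, Chen–Kiming–Wiese).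
Level raising modulo `pⁿ` at `n`-admissible primes (Bertolini–Darmon 2005, Thm. 3.3 shape) outputs only a
surjection `𝕋 → ℤ/pⁿ` of a HECKE ALGEBRA ("weak" eigenform mod `pⁿ`). For `n = 1` weak ⇒ strong (a maximal ideal
contains a minimal prime; Deligne–Serre lifting); for `n ≥ 2` it does not: -/

/-- The Hecke algebra of two newforms with integer eigenvalues congruent mod `p`: pairs `(a, b)` with
`a ≡ b (mod p)` (the fibre product `ℤ ×_{𝔽_p} ℤ`). -/
def CongruentPairs (p : ℕ) : Subring (ℤ × ℤ) where
  carrier := {x | (p : ℤ) ∣ x.1 - x.2}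
  mul_mem' {x y} hx hy := by
    simp only [Set.mem_setOf_eq, Prod.fst_mul, Prod.snd_mul] at *
    have : x.1 * y.1 - x.2 * y.2 = x.1 * (y.1 - y.2) + (x.1 - x.2) * y.2 := by ring
    rw [this]
    exact dvd_add (dvd_mul_of_dvd_right hy _) (dvd_mul_of_dvd_left hx _)
  one_mem' := by simp
  add_mem' {x y} hx hy := by
    simp only [Set.mem_setOf_eq, Prod.fst_add, Prod.snd_add] at *
    have : x.1 + y.1 - (x.2 + y.2) = (x.1 - x.2) + (y.1 - y.2) := by ring
    rw [this]
    exact dvd_add hx hy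
  zero_mem' := by simp
  neg_mem' {x} hx := by
    simp only [Set.mem_setOf_eq, Prod.fst_neg, Prod.snd_neg] at *
    have : -x.1 - -x.2 = -(x.1 - x.2) := by ring
    rw [this]
    exact (dvd_neg).mpr hx

/-- A depth-2 eigen-system of `CongruentPairs p` that is the reduction of NEITHER factor:
`(a, b) ↦ 2a - b (mod p²)` (a ring map because `2(a-b)(a'-b') ≡ 0 mod p²`). -/
def twistedHom (p : ℕ) : CongruentPairs p →+* ZMod (p ^ 2) where
  toFun x := ((2 * x.1.1 - x.1.2 : ℤ) : ZMod (p ^ 2))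
  map_one' := by simp
  map_mul' x y := by
    obtain ⟨c, hc⟩ := x.2
    obtain ⟨d, hd⟩ := y.2
    have h1 : (↑(x * y) : ℤ × ℤ).1 = (↑x : ℤ × ℤ).1 * (↑y : ℤ × ℤ).1 := rfl
    have h2 : (↑(x * y) : ℤ × ℤ).2 = (↑x : ℤ × ℤ).2 * (↑y : ℤ × ℤ).2 := rfl
    simp only [h1, h2]
    rw [← Int.cast_mul, ZMod.intCast_eq_intCast_iff_dvd_sub]
    refine ⟨2 * c * d, ?_⟩
    have hx : (↑x : ℤ × ℤ).1 = (↑x : ℤ × ℤ).2 + p * c := by linarith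
    have hy : (↑y : ℤ × ℤ).1 = (↑y : ℤ × ℤ).2 + p * d := by linarith
    rw [hx, hy]
    push_cast
    ring
  map_zero' := by simp
  map_add' x y := by
    have h1 : (↑(x + y) : ℤ × ℤ).1 = (↑x : ℤ × ℤ).1 + (↑y : ℤ × ℤ).1 := rfl
    have h2 : (↑(x + y) : ℤ × ℤ).2 = (↑x : ℤ × ℤ).2 + (↑y : ℤ × ℤ).2 := rfl
    simp only [h1, h2]
    push_cast
    ring

/-- `(0, p)` and `(p, 0)` lie in the congruence algebra. -/
theorem zero_p_mem (p : ℕ) : ((0 : ℤ), (p : ℤ)) ∈ CongruentPairs p := ⟨-1, by simp⟩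
theorem p_zero_mem (p : ℕ) : ((p : ℤ), (0 : ℤ)) ∈ CongruentPairs p := ⟨1, by simp⟩

/-- `p ≠ 0` in `ZMod (p ^ 2)` for `p ≥ 2`, and `2p ≠ 0` for `p ≥ 3`. -/
theorem natCast_ne_zero_zmod_sq {p : ℕ} (hp : 2 ≤ p) : ((p : ℤ) : ZMod (p ^ 2)) ≠ 0 := by
  rw [Ne, ZMod.intCast_zmod_eq_zero_iff_dvd]
  push_cast
  intro h
  have : p ^ 2 ≤ p := Nat.le_of_dvd (by omega) (by exact_mod_cast h)
  nlinarith

theorem two_mul_natCast_ne_zero_zmod_sq {p : ℕ} (hp : 3 ≤ p) : ((2 * p : ℤ) : ZMod (p ^ 2)) ≠ 0 := by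
  rw [Ne, ZMod.intCast_zmod_eq_zero_iff_dvd]
  push_cast
  intro h
  have : p ^ 2 ≤ 2 * p := Nat.le_of_dvd (by omega) (by exact_mod_cast h)
  nlinarith

/-- **Weak ⇏ strong at depth 2.** The eigen-system `twistedHom p : 𝕋 → ℤ/p²` does not factor through the first
newform (`(a,b) ↦ a mod p²`) … -/
theorem twistedHom_not_factor_fst {p : ℕ} (hp : 2 ≤ p) :
    ¬ ∀ x : CongruentPairs p, twistedHom p x = ((x.1.1 : ℤ) : ZMod (p ^ 2)) := by
  intro h
  have := h ⟨_, zero_p_mem p⟩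
  simp only [twistedHom, RingHom.coe_mk, MonoidHom.coe_mk, OneHom.coe_mk, mul_zero, zero_sub,
    Int.cast_neg, Int.cast_zero, neg_eq_zero] at this
  exact natCast_ne_zero_zmod_sq hp this

/-- … nor through the second (`(a,b) ↦ b mod p²`), for `p ≥ 3`. So an eigenform mod `p²` of this Hecke
algebra is not the reduction of any genuine newform: `n`-admissible level raising (a map `𝕋 → ℤ/pⁿ`) is
strictly weaker than the crux's typed congruence for `n ≥ 2`. -/
theorem twistedHom_not_factor_snd {p : ℕ} (hp : 3 ≤ p) :
    ¬ ∀ x : CongruentPairs p, twistedHom p x = ((x.1.2 : ℤ) : ZMod (p ^ 2)) := by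
  intro h
  have := h ⟨_, p_zero_mem p⟩
  simp only [twistedHom, RingHom.coe_mk, MonoidHom.coe_mk, OneHom.coe_mk, sub_zero, Int.cast_zero] at this
  exact two_mul_natCast_ne_zero_zmod_sq hp (by exact_mod_cast this)

/-- **Ramified congruences are shallow.** If a commutative ring `R` contains `x` with `x² = p·u`, `u` a unit
(e.g. an order containing `√p`, or any coefficient ring in which the congruence prime over `p` is ramified with
`p` a uniformiser square up to a unit), then `R` admits NO ring map to `ZMod (p ^ n)` for `n ≥ 2`. Hence the
depth-`n` congruence of the crux, `n ≥ 2`, can only be carried by a prime of `O_g` that is UNRAMIFIED of residue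
degree one over `p`. (At `n = 1`, `x ↦ 0` is fine.) [folklore] -/
theorem no_ringHom_zmod_pow_of_sq_eq {R : Type*} [CommRing R] {p n : ℕ} (hp : p.Prime) (hn : 2 ≤ n)
    {x u : R} (hu : IsUnit u) (hx : x ^ 2 = (p : R) * u) (φ : R →+* ZMod (p ^ n)) : False := by
  -- push down to `ZMod (p ^ 2)`
  let ψ : R →+* ZMod (p ^ 2) := (ZMod.castHom (pow_dvd_pow p hn) (ZMod (p ^ 2))).comp φ
  have hψ : (ψ x) ^ 2 = (p : ZMod (p ^ 2)) * ψ u := by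
    rw [← map_pow, hx, map_mul, map_natCast]
  obtain ⟨v, hv⟩ := hu
  have hunit : IsUnit (ψ u) := by rw [← hv]; exact (Units.map ψ.toMonoidHom v).isUnit
  -- lift to integers
  obtain ⟨X, hX⟩ := ZMod.intCast_surjective (ψ x)
  obtain ⟨U, hU⟩ := ZMod.intCast_surjective (ψ u)
  obtain ⟨w, hw⟩ := hunit
  obtain ⟨V, hV⟩ := ZMod.intCast_surjective ((w⁻¹ : (ZMod (p ^ 2))ˣ) : ZMod (p ^ 2))
  have hUV : ((U * V : ℤ) : ZMod (p ^ 2)) = 1 := by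
    push_cast
    rw [hU, hV, ← hw, Units.mul_inv]
  have hXU : ((X ^ 2 : ℤ) : ZMod (p ^ 2)) = ((p * U : ℤ) : ZMod (p ^ 2)) := by
    push_cast
    rw [hX, hU, hψ]
  rw [ZMod.intCast_eq_intCast_iff_dvd_sub] at hXU
  rw [← Int.cast_one, ZMod.intCast_eq_intCast_iff_dvd_sub] at hUV
  push_cast at hXU hUV
  have hpp : Prime (p : ℤ) := Nat.prime_iff_prime_int.mp hp
  -- `p ∣ X`
  have hpX2 : (p : ℤ) ∣ X ^ 2 := by
    have : (p : ℤ) ∣ p * U - X ^ 2 := (dvd_pow_self (p : ℤ) two_ne_zero).trans hXU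
    have h2 : X ^ 2 = p * U - (p * U - X ^ 2) := by ring
    rw [h2]
    exact dvd_sub (dvd_mul_right _ _) this
  have hpX : (p : ℤ) ∣ X := hpp.dvd_of_dvd_pow hpX2
  -- hence `p² ∣ X²`, so `p² ∣ p U`, so `p ∣ U`
  have hp2X2 : (p : ℤ) ^ 2 ∣ X ^ 2 := pow_dvd_pow_of_dvd hpX 2
  have hp2pU : (p : ℤ) ^ 2 ∣ p * U := by
    have h2 : (p : ℤ) * U = (p * U - X ^ 2) + X ^ 2 := by ring
    rw [h2]
    exact dvd_add hXU hp2X2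
  have hpU : (p : ℤ) ∣ U := by
    obtain ⟨k, hk⟩ := hp2pU
    refine ⟨k, ?_⟩
    have hp0 : (p : ℤ) ≠ 0 := by exact_mod_cast hp.ne_zero
    have : (p : ℤ) * U = p * (p * k) := by rw [hk]; ring
    exact mul_left_cancel₀ hp0 this
  -- but `U V ≡ 1 mod p`
  have hp1 : (p : ℤ) ∣ 1 := by
    have h1 : (1 : ℤ) = U * V - (U * V - 1) := by ring
    have hpUV1 : (p : ℤ) ∣ U * V - 1 := by
      have := (dvd_pow_self (p : ℤ) two_ne_zero).trans hUV
      -- hUV : p^2 ∣ 1 - U * V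
      have h3 : U * V - 1 = -(1 - U * V) := by ring
      rw [h3]
      exact (dvd_neg).mpr this
    rw [h1]
    exact dvd_sub (dvd_mul_of_dvd_left hpU _) hpUV1
  exact hpp.not_dvd_one hp1

end Summit.BirchSwinnertonDyer.BirchSwinnertonDyer.Cruxes.PhantomShadow.Disproof
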